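import Summits.RiemannHypothesis.RiemannHypothesis.Theorems.SignConeCondRungRepresent
import Literature.NumberTheory.LFunctions.WeilGroundEnergyProofs

/-!
# Route SignCone — Krein–Turán rung, I: the Krein–Turán bound and the Schur test

Support for the crux `SignConeInequality` (stmt-RiemannHypothesis-16301; plan `Cruxes/SignConeInequality/KREIN-TURAN-RUNG.md`).
In the Krein–Turán form of the conditional rung theorem (Theorem A′, `SignConeKreinTuranTheoremA`) the prime comb is never
bounded pointwise: it is charged to the autocorrelation `V = v ⋆ ṽ` of the high-frequency part `v` of the test through the
**Krein–Turán constant** — the best `Π` in `Σ_{n ≤ N} (2Λ(n)/√n) Re V(log n) ≤ Π ‖v‖₂²` over tests `v` supported in an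
interval of length `L` (`KreinTuranBound N L Π`). The elementary **Schur test** certifies such a `Π`: if a weight `w`,
positive and bounded on `I = [-L/2, L/2]`, satisfies `(A w)(x) ≤ Π w(x)` on `I` for the symmetrised translation operator
`(A w)(x) = Σ_n (a_n/2)(w̄(x − log n) + w̄(x + log n))` (`w̄ = 1_I w`, `a_n = 2Λ(n)/√n`), then `KreinTuranBound N L Π`
(`kreinTuranBound_of_schurWeight`): per node `2 Re v(u) v̄(u−t) ≤ (w̄(u−t)/w(u))|v(u)|² + (w̄(u)/w(u−t))|v(u−t)|²`,
integrate, translate the second integral by `t`, and sum.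
-/

noncomputable section

-- `Summit.RiemannHypothesis.RiemannHypothesis.…` repeats a namespace component by design (D-0017 layout).
set_option linter.dupNamespace false

open scoped BigOperators ComplexConjugate Real Topology ArithmeticFunction.vonMangoldt
open Complex MeasureTheory Set Filter

namespace Summit.RiemannHypothesis.RiemannHypothesis.Theorems.SignCone

open Literature.NumberTheory.LFunctions

/-- **Krein–Turán bound** `Π` for the honest comb `a_n = 2Λ(n)/√n`, `n ≤ N`, on autocorrelations of Weil tests
supported in `[-L/2, L/2]`: `Σ_{n ≤ N} a_n Re (v ⋆ ṽ)(log n) ≤ Π ‖v‖₂²`. [folklore] -/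
def KreinTuranBound (N : ℕ) (L Pup : ℝ) : Prop :=
  ∀ v : ℝ → ℂ, IsWeilTest v → tsupport v ⊆ Icc (-(L / 2)) (L / 2) →
    ∑ n ∈ Finset.range (N + 1), 2 * Λ n / Real.sqrt n * ((weilConv v (weilReflect v)) (Real.log n)).re ≤
      Pup * weilNorm2Sq v

/-- **Schur weight**: a measurable `w`, positive and bounded on `I = [-L/2, L/2]`, with `(A w)(x) ≤ Π w(x)` on `I`,
`(A w)(x) = Σ_{n ≤ N} (a_n/2)(w̄(x − log n) + w̄(x + log n))`, `w̄ = 1_I · w`. [folklore] -/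
def SchurWeight (N : ℕ) (L Pup : ℝ) (w : ℝ → ℝ) : Prop :=
  Measurable w ∧ (∃ c C : ℝ, 0 < c ∧ ∀ x ∈ Icc (-(L / 2)) (L / 2), c ≤ w x ∧ w x ≤ C) ∧
  ∀ x ∈ Icc (-(L / 2)) (L / 2),
    ∑ n ∈ Finset.range (N + 1), (2 * Λ n / Real.sqrt n) / 2 *
      ((Icc (-(L / 2)) (L / 2)).indicator w (x - Real.log n) + (Icc (-(L / 2)) (L / 2)).indicator w (x + Real.log n))
      ≤ Pup * w x

section Schur

variable {N : ℕ} {L Pup : ℝ} {w : ℝ → ℝ} {v : ℝ → ℂ}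

/-- Weighted AM–GM for the real part of a product: `2 Re(z₁ z̄₂) ≤ (β/α)|z₁|² + (α/β)|z₂|²` (`α, β > 0`). [folklore] -/
theorem two_re_mul_conj_le {α β : ℝ} (hα : 0 < α) (hβ : 0 < β) (z₁ z₂ : ℂ) :
    2 * (z₁ * conj z₂).re ≤ ‖z₁‖ ^ 2 * β * α⁻¹ + ‖z₂‖ ^ 2 * α * β⁻¹ := by
  have h1 : (z₁ * conj z₂).re ≤ ‖z₁‖ * ‖z₂‖ := by
    refine (Complex.re_le_norm _).trans ?_
    rw [norm_mul, Complex.norm_conj]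
  have h2 : 2 * (‖z₁‖ * ‖z₂‖) ≤ ‖z₁‖ ^ 2 * β * α⁻¹ + ‖z₂‖ ^ 2 * α * β⁻¹ := by
    have key : ‖z₁‖ ^ 2 * β * α⁻¹ + ‖z₂‖ ^ 2 * α * β⁻¹ - 2 * (‖z₁‖ * ‖z₂‖) =
        (β * ‖z₁‖ - α * ‖z₂‖) ^ 2 / (α * β) := by
      field_simp
      ring
    have : 0 ≤ (β * ‖z₁‖ - α * ‖z₂‖) ^ 2 / (α * β) := by positivity
    linarith
  linarith

variable (hv : IsWeilTest v) (hvs : tsupport v ⊆ Icc (-(L / 2)) (L / 2))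
  (hw : Measurable w) {c C : ℝ} (hc : 0 < c) (hwb : ∀ x ∈ Icc (-(L / 2)) (L / 2), c ≤ w x ∧ w x ≤ C)

/-- Off `I` the test vanishes. [folklore] -/
theorem schur_v_eq_zero {x : ℝ} (hx : x ∉ Icc (-(L / 2)) (L / 2)) (hvs : tsupport v ⊆ Icc (-(L / 2)) (L / 2)) :
    v x = 0 :=
  image_eq_zero_of_notMem_tsupport fun h => hx (hvs h)

include hc hwb in
/-- The extended weight `w̄ = 1_I w` is bounded: `0 ≤ w̄ ≤ |C|`. [folklore] -/
theorem schur_indicator_bounds (y : ℝ) :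
    0 ≤ (Icc (-(L / 2)) (L / 2)).indicator w y ∧ (Icc (-(L / 2)) (L / 2)).indicator w y ≤ |C| := by
  by_cases hy : y ∈ Icc (-(L / 2)) (L / 2)
  · rw [indicator_of_mem hy]
    obtain ⟨h1, h2⟩ := hwb y hy
    exact ⟨by linarith, h2.trans (le_abs_self C)⟩
  · rw [indicator_of_notMem hy]
    exact ⟨le_rfl, abs_nonneg C⟩

include hc hwb in
/-- The reciprocal extended weight `w̄⁻¹` is bounded: `0 ≤ w̄⁻¹ ≤ c⁻¹`. [folklore] -/
theorem schur_indicator_inv_bounds (y : ℝ) :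
    0 ≤ ((Icc (-(L / 2)) (L / 2)).indicator w y)⁻¹ ∧ ((Icc (-(L / 2)) (L / 2)).indicator w y)⁻¹ ≤ c⁻¹ := by
  by_cases hy : y ∈ Icc (-(L / 2)) (L / 2)
  · rw [indicator_of_mem hy]
    obtain ⟨h1, _⟩ := hwb y hy
    have hpos : 0 < w y := hc.trans_le h1
    exact ⟨inv_nonneg.2 hpos.le, inv_anti₀ hc h1⟩
  · rw [indicator_of_notMem hy, inv_zero]
    exact ⟨le_rfl, inv_nonneg.2 hc.le⟩

include hvs hc hwb in
/-- **Pointwise weighted AM–GM along a translation**: for every `u` and shift `t`,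
`2 Re (v(u) v̄(u−t)) ≤ |v(u)|² w̄(u−t) w̄(u)⁻¹ + |v(u−t)|² w̄(u) w̄(u−t)⁻¹`. [folklore] -/
theorem schur_pointwise (t u : ℝ) :
    2 * (v u * conj (v (u - t))).re ≤
      ‖v u‖ ^ 2 * (Icc (-(L / 2)) (L / 2)).indicator w (u - t) * ((Icc (-(L / 2)) (L / 2)).indicator w u)⁻¹ +
        ‖v (u - t)‖ ^ 2 * (Icc (-(L / 2)) (L / 2)).indicator w u * ((Icc (-(L / 2)) (L / 2)).indicator w (u - t))⁻¹ := by
  set I : Set ℝ := Icc (-(L / 2)) (L / 2) with hI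
  by_cases hu : u ∈ I
  · by_cases hut : u - t ∈ I
    · rw [indicator_of_mem hu, indicator_of_mem hut]
      have hα : 0 < w u := hc.trans_le (hwb u hu).1
      have hβ : 0 < w (u - t) := hc.trans_le (hwb (u - t) hut).1
      exact two_re_mul_conj_le hα hβ (v u) (v (u - t))
    · rw [schur_v_eq_zero hut hvs, indicator_of_notMem hut]
      simp
  · rw [schur_v_eq_zero hu hvs, indicator_of_notMem hu]
    simp

include hv hw hc hwb in
/-- Integrability of `u ↦ |v(u)|² w̄(u − t) w̄(u)⁻¹`. [folklore] -/
theorem schur_integrable_left (t : ℝ) :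
    Integrable fun u => ‖v u‖ ^ 2 * (Icc (-(L / 2)) (L / 2)).indicator w (u - t) *
      ((Icc (-(L / 2)) (L / 2)).indicator w u)⁻¹ := by
  have hI : MeasurableSet (Icc (-(L / 2)) (L / 2)) := measurableSet_Icc
  have h2 : Integrable fun u => ‖v u‖ ^ 2 := hv.integrable_norm_sq
  have hm : Measurable fun u => (Icc (-(L / 2)) (L / 2)).indicator w (u - t) *
      ((Icc (-(L / 2)) (L / 2)).indicator w u)⁻¹ :=
    ((hw.indicator hI).comp (measurable_id.sub_const t)).mul (hw.indicator hI).inv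
  have hb : ∀ᵐ u : ℝ, ‖(Icc (-(L / 2)) (L / 2)).indicator w (u - t) *
      ((Icc (-(L / 2)) (L / 2)).indicator w u)⁻¹‖ ≤ |C| * c⁻¹ := by
    refine Eventually.of_forall fun u => ?_
    obtain ⟨a0, a1⟩ := schur_indicator_bounds hc hwb (u - t)
    obtain ⟨b0, b1⟩ := schur_indicator_inv_bounds hc hwb u
    rw [Real.norm_eq_abs, abs_mul, abs_of_nonneg a0, abs_of_nonneg b0]
    exact mul_le_mul a1 b1 b0 (abs_nonneg C)
  have := h2.mul_bdd hm.aestronglyMeasurable hb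
  refine this.congr (Eventually.of_forall fun u => ?_)
  ring

include hv hw hc hwb in
/-- Integrability of `u ↦ |v(u)|² w̄(u + t) w̄(u)⁻¹`. [folklore] -/
theorem schur_integrable_right (t : ℝ) :
    Integrable fun u => ‖v u‖ ^ 2 * (Icc (-(L / 2)) (L / 2)).indicator w (u + t) *
      ((Icc (-(L / 2)) (L / 2)).indicator w u)⁻¹ := by
  have := schur_integrable_left hv hw hc hwb (-t)
  simpa [sub_neg_eq_add] using this

include hv hvs hw hc hwb in
/-- **One node**: `2 Re (v ⋆ ṽ)(t) ≤ ∫ |v(u)|² (w̄(u−t) + w̄(u+t)) w̄(u)⁻¹ du`. [folklore] -/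
theorem two_re_weilConv_weilReflect_le (t : ℝ) :
    2 * (weilConv v (weilReflect v) t).re ≤
      ∫ u, ‖v u‖ ^ 2 * ((Icc (-(L / 2)) (L / 2)).indicator w (u - t) + (Icc (-(L / 2)) (L / 2)).indicator w (u + t)) *
        ((Icc (-(L / 2)) (L / 2)).indicator w u)⁻¹ := by
  set I : Set ℝ := Icc (-(L / 2)) (L / 2) with hI
  -- the autocorrelation as an integral
  have happ : weilConv v (weilReflect v) t = ∫ u, v u * conj (v (u - t)) := by
    rw [weilConv_apply]
    congr 1 with u
    simp [weilReflect, neg_sub]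
  have hint : Integrable fun u => v u * conj (v (u - t)) := by
    refine (hv.1.continuous.mul ?_).integrable_of_hasCompactSupport hv.2.mul_right
    exact (Complex.continuous_conj.comp (hv.1.continuous.comp (continuous_id.sub continuous_const)))
  have hre : (weilConv v (weilReflect v) t).re = ∫ u, (v u * conj (v (u - t))).re := by
    rw [happ]
    exact (integral_re hint).symm
  -- the two majorants
  have iL := schur_integrable_left hv hw hc hwb t
  have iR := schur_integrable_right hv hw hc hwb t
  have iS : Integrable fun u => ‖v (u - t)‖ ^ 2 * I.indicator w u * (I.indicator w (u - t))⁻¹ := by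
    have := iR.comp_sub_right t
    refine this.congr (Eventually.of_forall fun u => ?_)
    simp only [sub_add_cancel, hI]
  have hshift : (∫ u, ‖v (u - t)‖ ^ 2 * I.indicator w u * (I.indicator w (u - t))⁻¹) =
      ∫ u, ‖v u‖ ^ 2 * I.indicator w (u + t) * (I.indicator w u)⁻¹ := by
    have := integral_sub_right_eq_self (μ := (volume : Measure ℝ))
      (fun u => ‖v u‖ ^ 2 * I.indicator w (u + t) * (I.indicator w u)⁻¹) t
    simpa only [sub_add_cancel] using this
  have hpt : ∀ u, 2 * (v u * conj (v (u - t))).re ≤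
      ‖v u‖ ^ 2 * I.indicator w (u - t) * (I.indicator w u)⁻¹ +
        ‖v (u - t)‖ ^ 2 * I.indicator w u * (I.indicator w (u - t))⁻¹ :=
    fun u => schur_pointwise hvs hc hwb t u
  have i2 : Integrable fun u => 2 * (v u * conj (v (u - t))).re := hint.re.const_mul 2
  have hmono : (∫ u, 2 * (v u * conj (v (u - t))).re) ≤
      ∫ u, (‖v u‖ ^ 2 * I.indicator w (u - t) * (I.indicator w u)⁻¹ +
        ‖v (u - t)‖ ^ 2 * I.indicator w u * (I.indicator w (u - t))⁻¹) :=
    integral_mono i2 (iL.add iS) hpt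
  rw [integral_const_mul, integral_add iL iS, hshift, ← integral_add iL iR] at hmono
  rw [hre]
  refine hmono.trans (le_of_eq ?_)
  congr 1 with u
  ring

include hv hvs hw hc hwb in
/-- **The Schur test** ⇒ the Krein–Turán bound. [folklore] -/
theorem kreinTuranBound_of_schurWeight'
    (hS : ∀ x ∈ Icc (-(L / 2)) (L / 2),
      ∑ n ∈ Finset.range (N + 1), (2 * Λ n / Real.sqrt n) / 2 *
        ((Icc (-(L / 2)) (L / 2)).indicator w (x - Real.log n) + (Icc (-(L / 2)) (L / 2)).indicator w (x + Real.log n))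
        ≤ Pup * w x) :
    ∑ n ∈ Finset.range (N + 1), 2 * Λ n / Real.sqrt n * ((weilConv v (weilReflect v)) (Real.log n)).re ≤
      Pup * weilNorm2Sq v := by
  set I : Set ℝ := Icc (-(L / 2)) (L / 2) with hI
  set a : ℕ → ℝ := fun n => 2 * Λ n / Real.sqrt n with ha
  have ha0 : ∀ n, 0 ≤ a n := fun n =>
    div_nonneg (mul_nonneg zero_le_two ArithmeticFunction.vonMangoldt_nonneg) (Real.sqrt_nonneg _)
  -- the per-node majorant
  set F : ℕ → ℝ → ℝ := fun n u => ‖v u‖ ^ 2 * (I.indicator w (u - Real.log n) + I.indicator w (u + Real.log n)) *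
    (I.indicator w u)⁻¹ with hF
  have hFi : ∀ n, Integrable (F n) := fun n => by
    have := (schur_integrable_left hv hw hc hwb (Real.log n)).add (schur_integrable_right hv hw hc hwb (Real.log n))
    refine this.congr (Eventually.of_forall fun u => ?_)
    simp only [hF, Pi.add_apply]
    ring
  have hnode : ∀ n, a n * (weilConv v (weilReflect v) (Real.log n)).re ≤ a n / 2 * ∫ u, F n u := fun n => by
    have h := two_re_weilConv_weilReflect_le hv hvs hw hc hwb (Real.log n)
    have := mul_le_mul_of_nonneg_left h (div_nonneg (ha0 n) zero_le_two)
    linarith [this]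
  -- sum and exchange
  have hsum : ∑ n ∈ Finset.range (N + 1), a n * (weilConv v (weilReflect v) (Real.log n)).re ≤
      ∫ u, ∑ n ∈ Finset.range (N + 1), a n / 2 * F n u := by
    rw [integral_finsetSum _ fun n _ => (hFi n).const_mul (a n / 2)]
    refine Finset.sum_le_sum fun n _ => ?_
    rw [integral_const_mul]
    exact hnode n
  refine hsum.trans ?_
  -- pointwise Schur bound
  have hpt : ∀ u, ∑ n ∈ Finset.range (N + 1), a n / 2 * F n u ≤ Pup * ‖v u‖ ^ 2 := by
    intro u
    have e : ∑ n ∈ Finset.range (N + 1), a n / 2 * F n u =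
        ‖v u‖ ^ 2 * (I.indicator w u)⁻¹ * ∑ n ∈ Finset.range (N + 1), a n / 2 *
          (I.indicator w (u - Real.log n) + I.indicator w (u + Real.log n)) := by
      rw [Finset.mul_sum]
      refine Finset.sum_congr rfl fun n _ => ?_
      simp only [hF]; ring
    rw [e]
    by_cases hu : u ∈ I
    · have hwu : 0 < w u := hc.trans_le (hwb u hu).1
      rw [indicator_of_mem hu]
      have hSu := hS u hu
      calc ‖v u‖ ^ 2 * (w u)⁻¹ * ∑ n ∈ Finset.range (N + 1), a n / 2 *
            (I.indicator w (u - Real.log n) + I.indicator w (u + Real.log n))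
          ≤ ‖v u‖ ^ 2 * (w u)⁻¹ * (Pup * w u) :=
            mul_le_mul_of_nonneg_left hSu (mul_nonneg (sq_nonneg _) (inv_nonneg.2 hwu.le))
        _ = Pup * ‖v u‖ ^ 2 := by field_simp
    · rw [schur_v_eq_zero hu hvs]
      simp
  have hI2 : Integrable fun u => Pup * ‖v u‖ ^ 2 := hv.integrable_norm_sq.const_mul Pup
  have hIs : Integrable fun u => ∑ n ∈ Finset.range (N + 1), a n / 2 * F n u :=
    integrable_finsetSum _ fun n _ => (hFi n).const_mul (a n / 2)
  refine (integral_mono hIs hI2 hpt).trans (le_of_eq ?_)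
  rw [integral_const_mul]
  rfl

/-- **The Schur test** (`SchurWeight N L Π w` for some `w`) gives the Krein–Turán bound `KreinTuranBound N L Π`. [folklore] -/
theorem kreinTuranBound_of_schurWeight (h : SchurWeight N L Pup w) : KreinTuranBound N L Pup := by
  obtain ⟨hw, ⟨c, C, hc, hwb⟩, hS⟩ := h
  intro v hv hvs
  exact kreinTuranBound_of_schurWeight' hv hvs hw hc hwb hS

end Schur

end Summit.RiemannHypothesis.RiemannHypothesis.Theorems.SignCone

end
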